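import Mathlib
import HarnessLib
import Literature.Analysis.Matrix.DetExp

/-!
# The exponential chart of the complex matrices at the identity: a local inverse of `exp`, and the logarithm of a special unitary matrix near `1` is skew-Hermitian and traceless

HONEST FRAMING: exact (Metropolis-corrected) sampling algorithms for lattice gauge theory;
figures of merit are autocorrelation/cost numbers at stated couplings and volumes; no
continuum-physics claim.

Venture `LatticeQCDFlow` (cell pub-lqcd), topic `Exactness`, FANOUT row 9 (eng-latcore, the
engine `latflow.core`: the `SU(N)` link Metropolis `U ← exp(X) U` of `updates.sweep_metropolis` /
`sun_2d.sweep_metropolis` and the HMC drift `U ← exp(εP) U` of `hmc.HMC`, `N ≥ 3`).  NEW WORK of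
the cell over Mathlib (the inverse function theorem `ContDiffAt.toOpenPartialHomeomorph` for the
analytic map `exp` on the Banach algebra of complex matrices with the `L∞`-operator norm,
`Matrix.exp_conjTranspose`, `Complex.exp_eq_one_iff`) and the tree's
`Literature.Analysis.Matrix.DetExp` (`det (exp X) = exp (tr X)`); nothing here is cited as a fact.
Printed counterpart, NAMED ONLY: Hall, *Lie Groups, Lie Algebras, and Representations* (2015)
Thm 2.8 / Prop. 2.9 (the matrix logarithm near the identity) and Cor. 3.45 (`exp` is a local
chart of a matrix Lie group).

THE POINT.  The tree has the measure-level exponential chart of `SU(2)` by an explicit formula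
(Bałaban) and nothing for `SU(N)`, `N ≥ 3` — the missing input of every ergodicity statement for
the engine's `SU(3)` Metropolis and HMC updates (`GroupMetropolisLinkErgodic.lean`,
`SU2MetropolisKickLaw.lean` list it as NOT CLAIMED).  This file is the first, purely analytic step of
a qualitative chart for all `N`: a two-sided local inverse `matrixLog` of `exp` at `1`, continuously
differentiable at `1`, and the algebra that puts `matrixLog U` in `𝔰𝔲(N)` for `U ∈ SU(N)` near `1`.

* §1 `matrixExpChart` — the inverse-function-theorem chart of `exp : M_n(ℂ) → M_n(ℂ)` at `0`
  (real-analytic, derivative the identity); `matrixLog := matrixExpChart.symm`;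
  `exp_matrixLog` / `matrixLog_exp` on the target / source; `matrixLog_one = 0`;
  `continuousOn_matrixLog`; **`contDiffAt_matrixLog_one`** (`C¹` at `1`).
* §2 `logChartSet` — the open neighbourhood of `1` on which `matrixLog` lands in the source together
  with its conjugate transpose and its negative and has trace of norm `< 2π`;
  **`conjTranspose_matrixLog`** — for `U` there with `Uᴴ U = 1`: `(log U)ᴴ = −log U` (both
  exponentiate to `U⁻¹` inside the injectivity domain); **`trace_matrixLog`** — if moreover
  `det U = 1`: `tr log U = 0` (`exp tr log U = det U = 1` and `|tr log U| < 2π`);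
  `matrixLog_mem_skewTraceless` — so `matrixLog U` is skew-Hermitian and traceless for every
  `U ∈ SU(N) ∩ logChartSet`.

NOT CLAIMED: any radius (the chart comes from the inverse function theorem, no estimate of its
size); a power series for the logarithm; `GL_n`, `U(n)` versions beyond what is stated.
-/

noncomputable section

namespace Summit.Ventures.LatticeQCDFlow.Exactness

open NormedSpace Set Filter Topology
open scoped Matrix Matrix.Norms.Operator

variable {n : Type*} [Fintype n] [DecidableEq n]

-- The scoped `L∞`-operator normed algebra structure on matrices is only reducibly defeq to the
-- Pi uniformity (as in Mathlib's `MatrixExponential.lean` and the tree's `DetExp.lean`).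
set_option backward.isDefEq.respectTransparency false

/-! ## §1 The inverse-function-theorem chart of `exp` at `0` -/

/-- `exp` on the complex matrices is real-analytic, in particular `C^ω` at `0`. -/
theorem contDiffAt_matrixExp (X : Matrix n n ℂ) : ContDiffAt ℝ ⊤ (exp : Matrix n n ℂ → Matrix n n ℂ) X :=
  (NormedSpace.exp_analytic (𝕂 := ℝ) X).contDiffAt

/-- The derivative of `exp` at `0` is the identity, read as a continuous linear equivalence. -/
theorem hasFDerivAt_matrixExp_zero :
    HasFDerivAt (exp : Matrix n n ℂ → Matrix n n ℂ)
      ((ContinuousLinearEquiv.refl ℝ (Matrix n n ℂ) : Matrix n n ℂ →L[ℝ] Matrix n n ℂ)) 0 :=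
  (hasStrictFDerivAt_exp_zero (𝕂 := ℝ) (𝔸 := Matrix n n ℂ)).hasFDerivAt

/-- **The exponential chart**: the open partial homeomorphism of the inverse function theorem for
`exp` at `0` (its forward map IS `exp`; `0 ∈ source`, `1 ∈ target`). -/
def matrixExpChart : OpenPartialHomeomorph (Matrix n n ℂ) (Matrix n n ℂ) :=
  (contDiffAt_matrixExp (n := n) 0).toOpenPartialHomeomorph exp hasFDerivAt_matrixExp_zero
    (by exact WithTop.top_ne_zero)

/-- The chart's forward map is `exp`. -/
@[simp] theorem matrixExpChart_coe : ⇑(matrixExpChart (n := n)) = exp := rfl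

/-- `0` is in the source of the chart. -/
theorem zero_mem_matrixExpChart_source : (0 : Matrix n n ℂ) ∈ (matrixExpChart (n := n)).source :=
  (contDiffAt_matrixExp (n := n) 0).mem_toOpenPartialHomeomorph_source hasFDerivAt_matrixExp_zero _

/-- `1 = exp 0` is in the target of the chart. -/
theorem one_mem_matrixExpChart_target : (1 : Matrix n n ℂ) ∈ (matrixExpChart (n := n)).target := by
  have h := (contDiffAt_matrixExp (n := n) 0).image_mem_toOpenPartialHomeomorph_target
    hasFDerivAt_matrixExp_zero (by exact WithTop.top_ne_zero)
  rwa [exp_zero] at h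

/-- The source and target are open. -/
theorem isOpen_matrixExpChart_source : IsOpen (matrixExpChart (n := n)).source := matrixExpChart.open_source

/-- The target is open. -/
theorem isOpen_matrixExpChart_target : IsOpen (matrixExpChart (n := n)).target := matrixExpChart.open_target

/-- **The matrix logarithm near the identity**: the inverse of the chart (a total function, meaningful
on the target). -/
def matrixLog : Matrix n n ℂ → Matrix n n ℂ := (matrixExpChart (n := n)).symm

/-- `exp (log U) = U` on the target. -/
theorem exp_matrixLog {U : Matrix n n ℂ} (hU : U ∈ (matrixExpChart (n := n)).target) : exp (matrixLog U) = U :=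
  matrixExpChart.right_inv hU

/-- `log (exp X) = X` on the source. -/
theorem matrixLog_exp {X : Matrix n n ℂ} (hX : X ∈ (matrixExpChart (n := n)).source) : matrixLog (exp X) = X :=
  matrixExpChart.left_inv hX

/-- `log` maps the target into the source. -/
theorem matrixLog_mem_source {U : Matrix n n ℂ} (hU : U ∈ (matrixExpChart (n := n)).target) :
    matrixLog U ∈ (matrixExpChart (n := n)).source :=
  matrixExpChart.map_target hU

/-- `exp` maps the source into the target. -/
theorem exp_mem_target {X : Matrix n n ℂ} (hX : X ∈ (matrixExpChart (n := n)).source) :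
    exp X ∈ (matrixExpChart (n := n)).target :=
  matrixExpChart.map_source hX

/-- `log 1 = 0`. -/
theorem matrixLog_one : matrixLog (1 : Matrix n n ℂ) = 0 := by
  have h := matrixLog_exp (zero_mem_matrixExpChart_source (n := n))
  rwa [exp_zero] at h

/-- `log` is continuous on the target. -/
theorem continuousOn_matrixLog : ContinuousOn (matrixLog (n := n)) (matrixExpChart (n := n)).target :=
  matrixExpChart.continuousOn_symm

/-- **`log` is `C¹` at `1`** (the easy direction of the inverse function theorem). -/
theorem contDiffAt_matrixLog_one : ContDiffAt ℝ 1 (matrixLog (n := n)) 1 := by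
  have h := (contDiffAt_matrixExp (n := n) 0).to_localInverse hasFDerivAt_matrixExp_zero
    (by exact WithTop.top_ne_zero)
  rw [exp_zero] at h
  exact h.of_le le_top

/-! ## §2 The logarithm of a special unitary matrix near `1` is skew-Hermitian and traceless -/

/-- The neighbourhood of `1` on which the logarithm, its conjugate transpose and its negative all lie
in the injectivity domain of the chart and the trace of the logarithm has norm `< 2π`. -/
def logChartSet : Set (Matrix n n ℂ) :=
  (matrixExpChart (n := n)).target ∩ matrixLog ⁻¹'
    ((matrixExpChart (n := n)).source ∩ (fun X : Matrix n n ℂ => Xᴴ) ⁻¹' (matrixExpChart (n := n)).source ∩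
      (fun X : Matrix n n ℂ => -X) ⁻¹' (matrixExpChart (n := n)).source ∩
      {X : Matrix n n ℂ | ‖X.trace‖ < 2 * Real.pi})

omit [Fintype n] [DecidableEq n] in
/-- `X ↦ Xᴴ` is continuous on the complex matrices. -/
theorem continuous_conjTranspose_matrix : Continuous fun X : Matrix n n ℂ => Xᴴ :=
  continuous_id.matrix_conjTranspose

omit [DecidableEq n] in
/-- The trace is continuous. -/
theorem continuous_trace_matrix : Continuous fun X : Matrix n n ℂ => X.trace :=
  continuous_id.matrix_trace

/-- **`logChartSet` is open.** -/
theorem isOpen_logChartSet : IsOpen (logChartSet (n := n)) := by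
  refine continuousOn_matrixLog.isOpen_inter_preimage isOpen_matrixExpChart_target ?_
  refine ((isOpen_matrixExpChart_source.inter
    (isOpen_matrixExpChart_source.preimage continuous_conjTranspose_matrix)).inter
    (isOpen_matrixExpChart_source.preimage continuous_neg)).inter ?_
  exact isOpen_lt (continuous_norm.comp continuous_trace_matrix) continuous_const

/-- **`1 ∈ logChartSet`.** -/
theorem one_mem_logChartSet : (1 : Matrix n n ℂ) ∈ logChartSet (n := n) := by
  refine ⟨one_mem_matrixExpChart_target, ?_⟩
  simp only [mem_preimage, matrixLog_one, mem_inter_iff, Matrix.conjTranspose_zero, neg_zero, mem_setOf_eq,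
    Matrix.trace_zero, norm_zero]
  exact ⟨⟨⟨zero_mem_matrixExpChart_source, zero_mem_matrixExpChart_source⟩, zero_mem_matrixExpChart_source⟩,
    by positivity⟩

/-- `logChartSet ⊆ target`. -/
theorem logChartSet_subset_target : logChartSet (n := n) ⊆ (matrixExpChart (n := n)).target :=
  inter_subset_left

/-- **The logarithm of a unitary matrix near `1` is skew-Hermitian**: `(log U)ᴴ` and `−log U` both
exponentiate to `Uᴴ = U⁻¹` inside the injectivity domain. -/
theorem conjTranspose_matrixLog {U : Matrix n n ℂ} (hU : U ∈ logChartSet (n := n)) (hUU : Uᴴ * U = 1) :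
    (matrixLog U)ᴴ = -matrixLog U := by
  obtain ⟨hUt, ⟨⟨-, hct⟩, hneg⟩, -⟩ := hU
  have hU' : exp (matrixLog U) = U := exp_matrixLog hUt
  have hUU' : U * Uᴴ = 1 := mul_eq_one_comm.1 hUU
  have h1 : exp ((matrixLog U)ᴴ) = Uᴴ := by
    rw [Matrix.exp_conjTranspose, hU']
  have h2 : exp (-matrixLog U) = Uᴴ := by
    calc exp (-matrixLog U) = exp (-matrixLog U) * (exp (matrixLog U) * Uᴴ) := by rw [hU', hUU', mul_one]
      _ = Uᴴ := by
          rw [← mul_assoc, ← exp_add_of_commute (Commute.neg_left (Commute.refl (matrixLog U))),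
            neg_add_cancel, exp_zero, one_mul]
  have e1 : matrixLog (exp ((matrixLog U)ᴴ)) = (matrixLog U)ᴴ := matrixLog_exp hct
  have e2 : matrixLog (exp (-matrixLog U)) = -matrixLog U := matrixLog_exp hneg
  rw [h1] at e1
  rw [h2] at e2
  rw [← e1, ← e2]

/-- **The logarithm of a special unitary matrix near `1` is traceless**: `exp (tr log U) = det U = 1`
(Liouville) and `|tr log U| < 2π`. -/
theorem trace_matrixLog {U : Matrix n n ℂ} (hU : U ∈ logChartSet (n := n)) (hdet : U.det = 1) :
    (matrixLog U).trace = 0 := by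
  obtain ⟨hUt, -, htr⟩ := hU
  have hexp : Complex.exp (matrixLog U).trace = 1 := by
    rw [Complex.exp_eq_exp_ℂ, ← Literature.Analysis.Matrix.det_exp_eq_exp_trace, exp_matrixLog hUt, hdet]
  obtain ⟨k, hk⟩ := Complex.exp_eq_one_iff.1 hexp
  have hnorm : ‖(matrixLog U).trace‖ = |(k : ℝ)| * (2 * Real.pi) := by
    rw [hk, norm_mul, Complex.norm_intCast, norm_mul, Complex.norm_I, mul_one, Complex.norm_mul,
      Complex.norm_two, Complex.norm_real, Real.norm_of_nonneg Real.pi_pos.le]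
  have hk0 : k = 0 := by
    by_contra hk0
    have h1 : (1 : ℝ) ≤ |(k : ℝ)| := by
      rw [← Int.cast_abs]; exact_mod_cast Int.one_le_abs hk0
    have : 2 * Real.pi ≤ ‖(matrixLog U).trace‖ := by
      rw [hnorm]; nlinarith [Real.pi_pos]
    exact absurd htr (not_lt.2 this)
  rw [hk, hk0, Int.cast_zero, zero_mul]

/-- **For `U ∈ SU(N) ∩ logChartSet`, `matrixLog U` is skew-Hermitian and traceless.** -/
theorem matrixLog_mem_skewTraceless {U : Matrix.specialUnitaryGroup n ℂ}
    (hU : (U : Matrix n n ℂ) ∈ logChartSet (n := n)) :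
    (matrixLog (U : Matrix n n ℂ))ᴴ = -matrixLog (U : Matrix n n ℂ) ∧ (matrixLog (U : Matrix n n ℂ)).trace = 0 := by
  have hmem := Matrix.mem_specialUnitaryGroup_iff.1 U.2
  refine ⟨conjTranspose_matrixLog hU ?_, trace_matrixLog hU hmem.2⟩
  have h := Matrix.mem_unitaryGroup_iff'.1 hmem.1
  rwa [Matrix.star_eq_conjTranspose] at h

/-- `exp X ∈ SU(N)` for skew-Hermitian traceless `X`. -/
theorem exp_mem_specialUnitaryGroup_of_skew {X : Matrix n n ℂ} (hX : Xᴴ = -X) (hX0 : X.trace = 0) :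
    exp X ∈ Matrix.specialUnitaryGroup n ℂ := by
  rw [Matrix.mem_specialUnitaryGroup_iff]
  refine ⟨?_, ?_⟩
  · rw [Matrix.mem_unitaryGroup_iff, Matrix.star_eq_conjTranspose, ← Matrix.exp_conjTranspose, hX,
      ← exp_add_of_commute (Commute.neg_right (Commute.refl X)), add_neg_cancel, exp_zero]
  · rw [Literature.Analysis.Matrix.det_exp_eq_exp_trace, hX0, exp_zero]

/-- On `SU(N) ∩ logChartSet`, `exp ∘ log = id` (restated for the subtype). -/
theorem exp_matrixLog_coe {U : Matrix.specialUnitaryGroup n ℂ}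
    (hU : (U : Matrix n n ℂ) ∈ logChartSet (n := n)) : exp (matrixLog (U : Matrix n n ℂ)) = U :=
  exp_matrixLog (logChartSet_subset_target hU)

/-- The logarithm of an element of `logChartSet` lies in the source of the chart. -/
theorem matrixLog_mem_source_of_mem_logChartSet {U : Matrix n n ℂ} (hU : U ∈ logChartSet (n := n)) :
    matrixLog U ∈ (matrixExpChart (n := n)).source :=
  matrixLog_mem_source (logChartSet_subset_target hU)

end Summit.Ventures.LatticeQCDFlow.Exactness
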